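import Summits.QuantumAdvantage.QuantumAdvantage.Theorems.CharDialIslandDialA

/-!
# CharDialIslandDialB — TREE PART B of the decomp-qadv lens-5 g28 node «IslandDial»: NECESSITY OF PIECE E (the top Möbius layer of a
# junta ⊕ one-form function on its coefficient classes: `moeb_top_class`, `moeb_next_class`, `exchCoreAt_of_lawAt`) and the EXACT split
`target_iff_pieces : CharDial.FrobStructureLawOdd ↔ (ExchCoreOdd ∧ IslandOdd)`.  Verbatim from the node file (namespace `Theorems.IslandDial`).
-/

set_option autoImplicit false
set_option linter.dupNamespace false

namespace Summit.QuantumAdvantage.QuantumAdvantage.Theorems.IslandDial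

open Finset
open Summit.QuantumAdvantage.AdviceFreeQNC0
open Literature.Computability.MetaComplexity Literature.Computability.MetaComplexity.Smolensky

/-! ### Necessity of piece E — the top layer of a junta ⊕ one-form function (uses lens-6's `moeb_blockTop/Next`) -/

section NecessityE

variable {p : ℕ} [hp : Fact p.Prime] {n : ℕ}

/-- The one-form is invariant under a transposition of two coordinates with the same coefficient. -/
theorem form_comp_swap (a : Fin n → ZMod p) {i j : Fin n} (hij : a i = a j) (u : Fin n → Bool) :
    (∑ l, if (u ∘ Equiv.swap i j) l then a l else 0) = ∑ l, if u l then a l else 0 := by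
  have ha : ∀ l, a (Equiv.swap i j l) = a l := by
    intro l
    by_cases hli : l = i
    · rw [hli, Equiv.swap_apply_left]; exact hij.symm
    · by_cases hlj : l = j
      · rw [hlj, Equiv.swap_apply_right]; exact hij
      · rw [Equiv.swap_apply_of_ne_of_ne hli hlj]
  calc (∑ l, if (u ∘ Equiv.swap i j) l then a l else 0)
      = ∑ l, (fun x => if u x then a x else 0) (Equiv.swap i j l) := by
        refine Finset.sum_congr rfl fun l _ => ?_
        show (if u (Equiv.swap i j l) then a l else 0) = if u (Equiv.swap i j l) then a (Equiv.swap i j l) else 0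
        rw [ha l]
    _ = ∑ l, if u l then a l else 0 := Equiv.sum_comp (Equiv.swap i j) (fun x => if u x then a x else 0)

/-- In the normal form `f u = h(u|_J, Σ [uᵢ]aᵢ)`, two non-junta coordinates with equal coefficients are exchangeable. -/
theorem exch_of_normalForm {J : Finset (Fin n)} {a : Fin n → ZMod p} {h : (Fin n → Bool) → ZMod p → Bool}
    (hdep : ∀ u v : Fin n → Bool, (∀ i ∈ J, u i = v i) → ∀ s, h u s = h v s)
    {f : (Fin n → Bool) → Bool} (hrep : ∀ u, f u = h u (∑ i, if u i then a i else 0))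
    {i j : Fin n} (hi : i ∉ J) (hj : j ∉ J) (hij : a i = a j) (u : Fin n → Bool) :
    f (u ∘ Equiv.swap i j) = f u := by
  rw [hrep, hrep, form_comp_swap a hij u]
  refine hdep _ _ (fun l hl => ?_) _
  have hli : l ≠ i := fun e => hi (e ▸ hl)
  have hlj : l ≠ j := fun e => hj (e ▸ hl)
  show u (Equiv.swap i j l) = u l
  rw [Equiv.swap_apply_of_ne_of_ne hli hlj]

/-- Two disjoint classes as a `Fin 2`-indexed block family are pairwise disjoint. -/
theorem disjoint_two {B₀ B₁ : Finset (Fin n)} (hd : Disjoint B₀ B₁) :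
    ∀ j k : Fin 2, j ≠ k → Disjoint ((![B₀, B₁] : Fin 2 → Finset (Fin n)) j) (![B₀, B₁] k) := by
  intro j k hjk
  fin_cases j <;> fin_cases k
  · exact absurd rfl hjk
  · simpa using hd
  · simpa using hd.symm
  · exact absurd rfl hjk

/-- On a vertex `1_T` with `T` inside two coefficient classes, the one-form equals the two-block form. -/
theorem form_vert_two {B₀ B₁ : Finset (Fin n)} (hd : Disjoint B₀ B₁) (a : Fin n → ZMod p) {c₀ c₁ : ZMod p}
    (h₀ : ∀ i ∈ B₀, a i = c₀) (h₁ : ∀ i ∈ B₁, a i = c₁) {T : Finset (Fin n)} (hT : T ⊆ B₀ ∪ B₁) :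
    (∑ i, if SubLog.vert T i then a i else 0) = SubChar.blin ![B₀, B₁] ![c₀, c₁] (SubLog.vert T) := by
  classical
  have hL : (∑ i, if SubLog.vert T i then a i else 0) = ∑ i ∈ T, a i := by
    simp only [SubLog.vert, decide_eq_true_eq]
    rw [Finset.sum_ite_mem, Finset.univ_inter]
  have hsplit : T = T ∩ B₀ ∪ T ∩ B₁ := by
    rw [← Finset.inter_union_distrib_left, Finset.inter_eq_left.2 hT]
  have hdis' : Disjoint (T ∩ B₀) (T ∩ B₁) :=
    hd.mono Finset.inter_subset_right Finset.inter_subset_right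
  have hS₀ : ∑ i ∈ T ∩ B₀, a i = c₀ * ((T ∩ B₀).card : ZMod p) := by
    rw [Finset.sum_congr rfl fun i hi => h₀ i (Finset.mem_inter.1 hi).2, Finset.sum_const, nsmul_eq_mul, mul_comm]
  have hS₁ : ∑ i ∈ T ∩ B₁, a i = c₁ * ((T ∩ B₁).card : ZMod p) := by
    rw [Finset.sum_congr rfl fun i hi => h₁ i (Finset.mem_inter.1 hi).2, Finset.sum_const, nsmul_eq_mul, mul_comm]
  rw [hL]
  conv_lhs => rw [hsplit]
  rw [Finset.sum_union hdis', hS₀, hS₁]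
  unfold SubChar.blin
  rw [Fin.sum_univ_two]
  simp only [Matrix.cons_val_zero, Matrix.cons_val_one, SubChar.bw_vert]

/-- Möbius coefficients of `f = h(u|_J, Σ[uᵢ]aᵢ)` inside two non-junta coefficient classes are those of the two-block
function `u ↦ [h(0, blin u)]`. -/
theorem moeb_match_two {f : (Fin n → Bool) → Bool} {J : Finset (Fin n)} {a : Fin n → ZMod p}
    {h : (Fin n → Bool) → ZMod p → Bool}
    (hdep : ∀ u v : Fin n → Bool, (∀ i ∈ J, u i = v i) → ∀ s, h u s = h v s)
    (hrep : ∀ u, f u = h u (∑ i, if u i then a i else 0))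
    {B₀ B₁ : Finset (Fin n)} (hd : Disjoint B₀ B₁) {c₀ c₁ : ZMod p}
    (h₀ : ∀ i ∈ B₀, a i = c₀) (h₁ : ∀ i ∈ B₁, a i = c₁) (hJ : ∀ i ∈ B₀ ∪ B₁, i ∉ J)
    {S : Finset (Fin n)} (hS : S ⊆ B₀ ∪ B₁) :
    SubLog.moeb (SubLog.indR (ZMod p) f) S =
      SubLog.moeb (fun u => if h (fun _ => false) (SubChar.blin ![B₀, B₁] ![c₀, c₁] u) then (1 : ZMod p) else 0) S := by
  classical
  refine SubLog.moeb_congr_on fun T hT => ?_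
  show (if f (SubLog.vert T) then (1 : ZMod p) else 0) = _
  have hagree : ∀ i ∈ J, SubLog.vert T i = (fun _ : Fin n => false) i := by
    intro i hi
    have hiT : i ∉ T := fun hiT => hJ i (hS (hT hiT)) hi
    simp [SubLog.vert, hiT]
  rw [hrep, hdep _ _ hagree, form_vert_two hd a h₀ h₁ (hT.trans hS)]

/-- TOP: at `p − 1` coordinates of one class the coefficient is `[c₀ ≠ 0]·resCount h(0,·)` (odd `p`). -/
theorem moeb_top_class (hp2 : p ≠ 2) {f : (Fin n → Bool) → Bool} {J : Finset (Fin n)} {a : Fin n → ZMod p}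
    {h : (Fin n → Bool) → ZMod p → Bool}
    (hdep : ∀ u v : Fin n → Bool, (∀ i ∈ J, u i = v i) → ∀ s, h u s = h v s)
    (hrep : ∀ u, f u = h u (∑ i, if u i then a i else 0))
    {B₀ B₁ : Finset (Fin n)} (hd : Disjoint B₀ B₁) {c₀ c₁ : ZMod p}
    (h₀ : ∀ i ∈ B₀, a i = c₀) (h₁ : ∀ i ∈ B₁, a i = c₁) (hJ : ∀ i ∈ B₀ ∪ B₁, i ∉ J)
    {S : Finset (Fin n)} (hS : S ⊆ B₀) (hcard : S.card = p - 1) :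
    SubLog.moeb (SubLog.indR (ZMod p) f) S = if c₀ = 0 then 0 else SubChar.resCount (h fun _ => false) := by
  classical
  rw [moeb_match_two hdep hrep hd h₀ h₁ hJ (hS.trans Finset.subset_union_left),
    SubChar.moeb_blockTop (disjoint_two hd) (j := 0) (by simpa using hS) hcard (h fun _ => false) ![c₀, c₁],
    SubChar.sum_range_ind, Even.neg_one_pow (hp.out.even_sub_one hp2), one_mul]
  rfl

/-- NEXT: at `p − 2` coordinates of class `c₀ ≠ 0` plus one coordinate of class `c₁` the coefficient is
`(c₁/c₀)·resCount h(0,·)` (odd `p`). -/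
theorem moeb_next_class (hp2 : p ≠ 2) {f : (Fin n → Bool) → Bool} {J : Finset (Fin n)} {a : Fin n → ZMod p}
    {h : (Fin n → Bool) → ZMod p → Bool}
    (hdep : ∀ u v : Fin n → Bool, (∀ i ∈ J, u i = v i) → ∀ s, h u s = h v s)
    (hrep : ∀ u, f u = h u (∑ i, if u i then a i else 0))
    {B₀ B₁ : Finset (Fin n)} (hd : Disjoint B₀ B₁) {c₀ c₁ : ZMod p} (hc₀ : c₀ ≠ 0)
    (h₀ : ∀ i ∈ B₀, a i = c₀) (h₁ : ∀ i ∈ B₁, a i = c₁) (hJ : ∀ i ∈ B₀ ∪ B₁, i ∉ J)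
    {S : Finset (Fin n)} (hS : S ⊆ B₀) (hcard : S.card = p - 2) {k0 : Fin n} (hk0 : k0 ∈ B₁) :
    SubLog.moeb (SubLog.indR (ZMod p) f) (insert k0 S) = (c₁ / c₀) * SubChar.resCount (h fun _ => false) := by
  classical
  have hsub : insert k0 S ⊆ B₀ ∪ B₁ :=
    Finset.insert_subset (Finset.mem_union_right _ hk0) (hS.trans Finset.subset_union_left)
  rw [moeb_match_two hdep hrep hd h₀ h₁ hJ hsub,
    SubChar.moeb_blockNext (disjoint_two hd) (j := 0) (k := 1) (by decide) (by simpa using hS) hcard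
      (by simpa using hk0) (h fun _ => false) ![c₀, c₁],
    SubChar.sum_range_moment _ (show (![c₀, c₁] : Fin 2 → ZMod p) 0 ≠ 0 from hc₀),
    Odd.neg_one_pow (hp.out.odd_of_ne_two hp2)]
  show -1 * (-(c₁ / c₀) * SubChar.resCount (h fun _ => false)) = c₁ / c₀ * SubChar.resCount (h fun _ => false)
  ring

/-- **T at one prime ⟹ piece E at that prime** (odd `p`): in the normal form the constant non-zero top layer forces ONE
coefficient class to carry all of `X` but `≤ J₀ + p²` coordinates, and a coefficient class is exchangeable. -/
theorem exchCoreAt_of_lawAt (p : ℕ) [hp : Fact p.Prime] (hp2 : p ≠ 2)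
    (hT : ∃ J₀ : ℕ, ∀ (n : ℕ) (f : (Fin n → Bool) → Bool), HasDegF p f (p - 1) → NormalForm p f J₀) :
    ExchCoreAt p := by
  classical
  obtain ⟨J₀, hJ₀⟩ := hT
  refine ⟨J₀ + p * p, fun n f X hf hγ => ?_⟩
  obtain ⟨γ, hγ0, htop⟩ := hγ
  obtain ⟨J, hJ, a, h, hdep, hrep⟩ := hJ₀ n f hf
  -- coefficient classes of the non-junta coordinates of X
  set B : ZMod p → Finset (Fin n) := fun c => (X \ J).filter fun i => a i = c with hB
  have hBX : ∀ c, B c ⊆ X := fun c i hi => (Finset.mem_sdiff.1 (Finset.mem_filter.1 hi).1).1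
  have hBJ : ∀ c, ∀ i ∈ B c, i ∉ J := fun c i hi => (Finset.mem_sdiff.1 (Finset.mem_filter.1 hi).1).2
  have hBa : ∀ c, ∀ i ∈ B c, a i = c := fun c i hi => (Finset.mem_filter.1 hi).2
  have hBdis : ∀ c c', c ≠ c' → Disjoint (B c) (B c') := by
    intro c c' hcc'
    rw [Finset.disjoint_left]
    intro i hi hi'
    exact hcc' ((hBa c i hi).symm.trans (hBa c' i hi'))
  have hJ2 : ∀ c c', ∀ i ∈ B c ∪ B c', i ∉ J := by
    intro c c' i hi
    rcases Finset.mem_union.1 hi with hi | hi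
    · exact hBJ c i hi
    · exact hBJ c' i hi
  set R : ZMod p := SubChar.resCount (h fun _ => false) with hR
  -- TOP on a class with ≥ p − 1 members
  have hTOP : ∀ c, p - 1 ≤ (B c).card → γ = if c = 0 then 0 else R := by
    intro c hc
    obtain ⟨S, hS, hScard⟩ := Finset.exists_subset_card_eq hc
    have hc1 : c ≠ c + 1 := by
      intro e
      have : (1 : ZMod p) = 0 := by
        calc (1 : ZMod p) = (c + 1) - c := by ring
          _ = 0 := by rw [← e, sub_self]
      exact one_ne_zero this
    rw [← htop S (hS.trans (hBX c)) hScard]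
    exact moeb_top_class hp2 hdep hrep (hBdis c (c + 1) hc1) (hBa c) (hBa (c + 1)) (hJ2 c (c + 1)) hS hScard
  -- NEXT on a class `c ≠ 0` with ≥ p − 1 members against any member of another class
  have hNEXT : ∀ c c', c ≠ c' → c ≠ 0 → p - 1 ≤ (B c).card → ∀ k0 ∈ B c', γ = (c' / c) * R := by
    intro c c' hcc' hc0 hc k0 hk0
    obtain ⟨S, hS, hScard⟩ := Finset.exists_subset_card_eq (show p - 2 ≤ (B c).card by omega)
    have hk0S : k0 ∉ S := fun hk => Finset.disjoint_left.1 (hBdis c c' hcc') (hS hk) hk0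
    have hins : insert k0 S ⊆ X := Finset.insert_subset (hBX c' hk0) (hS.trans (hBX c))
    have hcard' : (insert k0 S).card = p - 1 := by
      rw [Finset.card_insert_of_notMem hk0S, hScard]
      have := hp.out.two_le
      omega
    rw [← htop (insert k0 S) hins hcard']
    exact moeb_next_class hp2 hdep hrep (hBdis c c' hcc') hc0 (hBa c) (hBa c') (hJ2 c c') hS hScard hk0
  -- (Z) the zero class is small
  have hZ : (B 0).card ≤ p - 2 := by
    by_contra hlt
    have hge : p - 1 ≤ (B 0).card := by omega
    have := hTOP 0 hge
    rw [if_pos rfl] at this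
    exact hγ0 this
  -- the junta part of X
  have hXJ : (X.filter fun i => i ∈ J).card ≤ J₀ :=
    le_trans (Finset.card_le_card fun i hi => (Finset.mem_filter.1 hi).2) hJ
  by_cases hbig : ∃ c, c ≠ 0 ∧ p - 1 ≤ (B c).card
  · obtain ⟨c, hc0, hc⟩ := hbig
    have hRγ : γ = R := by
      have := hTOP c hc
      rwa [if_neg hc0] at this
    have hempty : ∀ c', c' ≠ c → B c' = ∅ := by
      intro c' hc'
      by_contra hne
      obtain ⟨k0, hk0⟩ := Finset.nonempty_iff_ne_empty.2 hne
      have h1 := hNEXT c c' (Ne.symm hc') hc0 hc k0 hk0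
      rw [← hRγ] at h1
      have h2 : (c' / c - 1) * γ = 0 := by
        rw [sub_mul, one_mul, ← h1, sub_self]
      rcases mul_eq_zero.1 h2 with h3 | h3
      · exact hc' ((div_eq_one_iff_eq hc0).1 (sub_eq_zero.1 h3))
      · exact hγ0 h3
    refine ⟨B c, hBX c, ?_, fun i hi j hj u =>
      exch_of_normalForm hdep hrep (hBJ c i hi) (hBJ c j hj) ((hBa c i hi).trans (hBa c j hj).symm) u⟩
    have hcover : X ⊆ (X.filter fun i => i ∈ J) ∪ B c := by
      intro i hi
      by_cases hiJ : i ∈ J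
      · exact Finset.mem_union_left _ (Finset.mem_filter.2 ⟨hi, hiJ⟩)
      · refine Finset.mem_union_right _ (Finset.mem_filter.2 ⟨Finset.mem_sdiff.2 ⟨hi, hiJ⟩, ?_⟩)
        by_contra hne
        have hmem : i ∈ B (a i) := Finset.mem_filter.2 ⟨Finset.mem_sdiff.2 ⟨hi, hiJ⟩, rfl⟩
        rw [hempty (a i) hne] at hmem
        exact Finset.notMem_empty _ hmem
    calc X.card ≤ ((X.filter fun i => i ∈ J) ∪ B c).card := Finset.card_le_card hcover
      _ ≤ (X.filter fun i => i ∈ J).card + (B c).card := Finset.card_union_le _ _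
      _ ≤ (B c).card + (J₀ + p * p) := by omega
  · simp only [not_exists, not_and, not_le] at hbig
    have hsmall : ∀ c, (B c).card ≤ p - 2 := by
      intro c
      by_cases hc : c = 0
      · rw [hc]; exact hZ
      · have := hbig c hc; omega
    refine ⟨∅, Finset.empty_subset _, ?_, fun i hi => absurd hi (Finset.notMem_empty _)⟩
    have hcover : X ⊆ (X.filter fun i => i ∈ J) ∪ Finset.univ.biUnion B := by
      intro i hi
      by_cases hiJ : i ∈ J
      · exact Finset.mem_union_left _ (Finset.mem_filter.2 ⟨hi, hiJ⟩)
      · exact Finset.mem_union_right _ (Finset.mem_biUnion.2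
          ⟨a i, Finset.mem_univ _, Finset.mem_filter.2 ⟨Finset.mem_sdiff.2 ⟨hi, hiJ⟩, rfl⟩⟩)
    have h1 : (Finset.univ.biUnion B).card ≤ p * (p - 2) := by
      calc (Finset.univ.biUnion B).card ≤ ∑ c, (B c).card := Finset.card_biUnion_le
        _ ≤ ∑ _c : ZMod p, (p - 2) := Finset.sum_le_sum fun c _ => hsmall c
        _ = p * (p - 2) := by rw [Finset.sum_const, Finset.card_univ, ZMod.card, smul_eq_mul]
    have h2 : p * (p - 2) ≤ p * p := Nat.mul_le_mul_left _ (Nat.sub_le _ _)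
    calc X.card ≤ ((X.filter fun i => i ∈ J) ∪ Finset.univ.biUnion B).card := Finset.card_le_card hcover
      _ ≤ (X.filter fun i => i ∈ J).card + (Finset.univ.biUnion B).card := Finset.card_union_le _ _
      _ ≤ (∅ : Finset (Fin n)).card + (J₀ + p * p) := by rw [Finset.card_empty]; omega

end NecessityE

/-- T ⟹ piece E (all odd primes `p ≥ 5` at once). -/
theorem exchCoreOdd_of_target (hT : Summit.QuantumAdvantage.QuantumAdvantage.Theses.CharDial.FrobStructureLawOdd) :
    ExchCoreOdd := by
  intro p _ hp
  obtain ⟨J₀, hJ₀⟩ := hT p hp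
  exact exchCoreAt_of_lawAt p (by omega) ⟨J₀, fun n f hf => hJ₀ n f hf⟩

/-- EXACTNESS of the node: `T ⟺ ExchCoreOdd ∧ IslandOdd`. -/
theorem target_iff_pieces :
    Summit.QuantumAdvantage.QuantumAdvantage.Theses.CharDial.FrobStructureLawOdd ↔ (ExchCoreOdd ∧ IslandOdd) :=
  ⟨fun hT => ⟨exchCoreOdd_of_target hT, islandOdd_of_target hT⟩, fun h => closes h.1 h.2⟩



end Summit.QuantumAdvantage.QuantumAdvantage.Theorems.IslandDial
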